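import Literature.MathematicalPhysics.QuantumFieldTheory.Balaban1983to89.NodeOLettersOfWalksPerturbative

/-!
# `Balaban1983to89.B13NodeTorusWalksGammaForm` — NODE A's FORM BOUND `hΓq` OF THE (2.24)–(2.25) SMALLNESS IS A NUMBER OF
# THE W-WALKS PACKAGE: `(Γ₀X)·C(Γ₀X) ≤ g_q |X|²` with `g_q = B_Γ² c_V · m c₀(1,η)^{d_m} ∕ m_A`, from `TermWalks 𝒦 q`

statement-level bookkeeping over published theorems with citation tags; kernel-checked compositions of tree theorems and
elementary linear algebra; nothing here is a claim about the Yang–Mills mass gap.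

Cell `pub-ymgap`, D-0062 Track A, node N10 = [Balaban1988RG2Cluster] Lemmas 1–3 (CMP 116); seat `dag-n10-c` (FAN-OUT §N10 s3),
module 6 — the third reduction of NODE A's structural inputs in the walks leaves (`B13NodeTorusWalksAccretive`, p453901, derived
`hA` (`Re A ≻ 0`) and the spectral bound `hcE` from the rung's accretivity; this file derives `hΓq`).

WHY.  The (2.24)–(2.25) step of [B13] Lemma 3 (`B13PrimitiveKernels216`, the walks leaves `b13Leaf_twoTorus_walks₂` ∕
`…uniformWalksAcross₂` ∕ the record version `N10AtRecord11B13Walks.b13LeafOfRecord_of_located_walks`) carries the hypothesis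
`hΓq : ∀ X, (Γ₀ X)·(C (Γ₀ X)) ≤ g_q (X·X)` — the quadratic form of the reference covariance `C = A(0,0)⁻¹` on the range of the
reference Γ-kernel `Γ₀ = Re G(0,0)`, with a constant `g_q` UNIFORM over the terms.  Print (p. 15, (2.16) p. 16) has both factors
from [13]: `|G(0,0)_{bξ}| ≤ B_Γ e^{−ρ′d(b,ξ)}` (the Γ-kernel's letters, `NodeOLetters.TermLetters.hΓ` via
`termLetters_of_termWalks`) and `C ≤ m_A⁻¹` (accretivity of `A` at the reference pair).  THIS FILE proves it from the rung
`TermWalks 𝒦 q` (standard rate book, `η ≤ etaMax`, `η > 0`) and the two geometric letters every walks leaf already carries (the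
fibre bound `m` of the row locations, the member dimension `ν ≤ d_m`): SCHUR's test on the real rectangular matrix `Γ₀` — row
sums `≤ B_Γ c_V` by the rung's volume clause `volΛN` (rate `η ≤ ρ′ = μ∕4`), column sums `≤ B_Γ · m c₀(1,η)^{d_m}` by torus
geometry (`NodeOLettersOfWalksPerturbative.volume_of_multiplicity`, [Balaban1984PropagatorsII] (2.61)) — and the form bound
`v·Cv ≤ |v|²∕m_A` from the `m_A`-accretivity of `A(0,0)` at `w = Cv` (Cauchy–Schwarz; no spectral theory).  Hence
`g_q := B_Γ² c_V · m c₀(1,η)^{d_m} ∕ m_A`, a NUMBER OF THE PACKAGE — the binder `hΓq` of the walks leaves is dischargeable per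
term by `gammaForm_le_of_termWalks` (the ₃ editions of the leaves without `hΓq` are left to a successor: binder lists otherwise
verbatim).
* §1 [folklore] private helpers: Schur's test for a real rectangular matrix in quadratic-form shape; the form of the inverse of
  an accretive matrix.
* §2 per-term readers: `form_C_le_of_termWalks` (`v·Cv ≤ |v|²∕m_A`), `abs_gamma0_le_of_termWalks` (`|Γ₀ᵢⱼ| ≤ B_Γ e^{−ρ′d}` at
  any rate book), ★ `gammaForm_le_of_termWalks`.

CITATIONS.  [Balaban1988RG2Cluster] T. Bałaban, Comm. Math. Phys. 116 (1988) 1–22: p. 15, (2.16) p. 16, (2.24)–(2.25) p. 17.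
[Balaban1985BackgroundPropagators] Comm. Math. Phys. 99 (1985): Thm 3.10 p. 416.  [Balaban1984PropagatorsII] Comm. Math. Phys. 96
(1984): Lemma 2.1 (2.61) p. 234.

HONEST FRAMING: a reduction of one displayed hypothesis to the rung `TermWalks` (itself NOT supplied for Bałaban's kernels —
NODE A ∕ in-edge N06); count-neutral Track-A side landing; N10 NOT discharged; nothing continuum ∕ ℝ⁴ ∕ OS ∕ mass-gap ∕ Clay.
0 `sorry`, 0 `def`, no instance, no notation; standard axioms.
-/

noncomputable section

namespace Literature.MathematicalPhysics.QuantumFieldTheory.Balaban1983to89.B13NodeTorusWalksGammaForm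

open Metric Set Finset
open scoped Matrix
open Literature.MathematicalPhysics.QuantumFieldTheory.Balaban1983to89
open Literature.MathematicalPhysics.QuantumFieldTheory.Balaban1983to89.B9Thm37GlueTorus (tdist1 tdist1_comm tdist1_nonneg)
open Literature.MathematicalPhysics.QuantumFieldTheory.Balaban1983to89.TreeLengthTorus (TPt)
open Literature.MathematicalPhysics.QuantumFieldTheory.Balaban1983to89.B5TorusCover (UT)
open Literature.MathematicalPhysics.QuantumFieldTheory.Balaban1983to89.B13TermWalkData (TermKernels)
open Literature.MathematicalPhysics.QuantumFieldTheory.Balaban1983to89.NodeOLettersOfWalksAcross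
  (WalkPackage RateBook TermWalks termLetters_of_termWalks)
open Literature.MathematicalPhysics.QuantumFieldTheory.Balaban1983to89.NodeOLettersOfWalksPerturbative (volume_of_multiplicity)

/-! ## §1. Two linear-algebra helpers -/

section LinearAlgebra

/-- **Schur's test, quadratic-form shape, real rectangular matrix**: row ℓ¹-sums `≤ r` (`r ≥ 0`) and column ℓ¹-sums `≤ s` give
`|MX|² ≤ r·s·|X|²` (row-wise weighted Cauchy–Schwarz, then exchange of sums). [folklore] -/
private theorem schur_sq_le {p n : Type*} [Fintype p] [Fintype n] (M : Matrix p n ℝ) {r s : ℝ} (hr0 : 0 ≤ r)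
    (hr : ∀ i, ∑ j, |M i j| ≤ r) (hs : ∀ j, ∑ i, |M i j| ≤ s) (X : n → ℝ) :
    (M *ᵥ X) ⬝ᵥ (M *ᵥ X) ≤ r * s * (X ⬝ᵥ X) := by
  -- row-wise: ((MX)_i)² ≤ (Σ_j |M_ij|)(Σ_j |M_ij| X_j²) ≤ r · Σ_j |M_ij| X_j²
  have hrow : ∀ i, (M *ᵥ X) i * (M *ᵥ X) i ≤ r * ∑ j, |M i j| * X j ^ 2 := by
    intro i
    have h1 : |(M *ᵥ X) i| ≤ ∑ j, |M i j| * |X j| := by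
      simp only [Matrix.mulVec, dotProduct]
      exact (Finset.abs_sum_le_sum_abs _ _).trans (le_of_eq (Finset.sum_congr rfl fun j _ => abs_mul _ _))
    have h2 : (∑ j, |M i j| * |X j|) ^ 2 ≤ (∑ j, |M i j|) * (∑ j, |M i j| * X j ^ 2) := by
      have h := Finset.sum_mul_sq_le_sq_mul_sq Finset.univ (fun j => Real.sqrt |M i j|)
        (fun j => Real.sqrt |M i j| * |X j|)
      have e1 : ∀ j, Real.sqrt |M i j| * (Real.sqrt |M i j| * |X j|) = |M i j| * |X j| := fun j => by
        rw [← mul_assoc, Real.mul_self_sqrt (abs_nonneg _)]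
      have e2 : ∀ j, Real.sqrt |M i j| ^ 2 = |M i j| := fun j => Real.sq_sqrt (abs_nonneg _)
      have e3 : ∀ j, (Real.sqrt |M i j| * |X j|) ^ 2 = |M i j| * X j ^ 2 := fun j => by
        rw [mul_pow, Real.sq_sqrt (abs_nonneg _), sq_abs]
      simp only [e1, e2, e3] at h
      exact h
    have hnn : 0 ≤ ∑ j, |M i j| * X j ^ 2 := Finset.sum_nonneg fun j _ => mul_nonneg (abs_nonneg _) (sq_nonneg _)
    have h4 : |(M *ᵥ X) i| ^ 2 ≤ (∑ j, |M i j| * |X j|) ^ 2 := pow_le_pow_left₀ (abs_nonneg _) h1 2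
    calc (M *ᵥ X) i * (M *ᵥ X) i = |(M *ᵥ X) i| ^ 2 := by rw [sq_abs, sq]
      _ ≤ (∑ j, |M i j|) * (∑ j, |M i j| * X j ^ 2) := h4.trans h2
      _ ≤ r * ∑ j, |M i j| * X j ^ 2 := mul_le_mul_of_nonneg_right (hr i) hnn
  -- sum over rows, exchange, column sums
  have hx : ∀ j, (∑ i, |M i j|) * X j ^ 2 ≤ s * X j ^ 2 := fun j => mul_le_mul_of_nonneg_right (hs j) (sq_nonneg _)
  calc (M *ᵥ X) ⬝ᵥ (M *ᵥ X) = ∑ i, (M *ᵥ X) i * (M *ᵥ X) i := rfl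
    _ ≤ ∑ i, r * ∑ j, |M i j| * X j ^ 2 := Finset.sum_le_sum fun i _ => hrow i
    _ = r * ∑ j, (∑ i, |M i j|) * X j ^ 2 := by
        rw [← Finset.mul_sum, Finset.sum_comm]
        congr 1
        exact Finset.sum_congr rfl fun j _ => by rw [Finset.sum_mul]
    _ ≤ r * ∑ j, s * X j ^ 2 := mul_le_mul_of_nonneg_left (Finset.sum_le_sum fun j _ => hx j) hr0
    _ = r * s * (X ⬝ᵥ X) := by
        rw [← Finset.mul_sum, mul_assoc]
        congr 2
        exact Finset.sum_congr rfl fun j _ => by rw [sq]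

/-- **The form of the inverse of an accretive matrix**: if `A⁻¹ = C` (complexified) with `C ≻ 0` real and `A` is `m`-accretive
(`m > 0`), then `v·Cv ≤ |v|²∕m` for every real `v` — test the accretivity at `w = Cv` (`Aw = v`): `m|w|² ≤ Re⟨w, Aw⟩ = w·v ≤
|w||v|`. [folklore] -/
private theorem form_inv_le_of_accretive {n : Type} [Fintype n] [DecidableEq n] {A : Matrix n n ℂ}
    {C : Matrix n n ℝ} (hC : C.PosDef) (hC0 : A⁻¹ = C.map (algebraMap ℝ ℂ)) {m : ℝ} (hm : 0 < m)
    (hacc : ∀ v : n → ℂ, m * ∑ i, ‖v i‖ ^ 2 ≤ (∑ i, star (v i) * (A *ᵥ v) i).re) (v : n → ℝ) :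
    v ⬝ᵥ (C *ᵥ v) ≤ 1 / m * (v ⬝ᵥ v) := by
  -- `A` is invertible, its inverse being `C` (complexified)
  have hCu : IsUnit C.det := hC.det_pos.ne'.isUnit
  have hmul : C⁻¹.map (algebraMap ℝ ℂ) * C.map (algebraMap ℝ ℂ) = 1 := by
    rw [← Matrix.map_mul, Matrix.nonsing_inv_mul C hCu, Matrix.map_one _ (map_zero _) (map_one _)]
  have hCmu : IsUnit (C.map (algebraMap ℝ ℂ)) :=
    (Matrix.isUnit_iff_isUnit_det _).2 (Matrix.isUnit_det_of_left_inverse hmul)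
  have hAu : IsUnit A.det := by
    rw [← Matrix.isUnit_iff_isUnit_det, ← Matrix.isUnit_nonsing_inv_iff, hC0]; exact hCmu
  -- `w := C v`, complexified; `A w = v`
  set w : n → ℝ := C *ᵥ v with hw
  set vc : n → ℂ := fun j => (v j : ℂ) with hvc
  set wc : n → ℂ := fun j => (w j : ℂ) with hwc
  have hw' : wc = (C.map (algebraMap ℝ ℂ)) *ᵥ vc := by
    funext j
    have h := RingHom.map_mulVec (algebraMap ℝ ℂ) C v j
    simpa [hwc, hvc, hw, Function.comp_def] using h
  have hAw : A *ᵥ wc = vc := by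
    rw [hw', ← hC0, Matrix.mulVec_mulVec, Matrix.mul_nonsing_inv A hAu, Matrix.one_mulVec]
  -- the accretivity at `w` reads `m (w·w) ≤ w·v`
  have h := hacc wc
  rw [hAw] at h
  have hL : ∑ j, ‖wc j‖ ^ 2 = w ⬝ᵥ w := by
    simp only [hwc, Complex.norm_real, Real.norm_eq_abs, dotProduct, sq]
    exact Finset.sum_congr rfl fun j _ => abs_mul_abs_self (w j)
  have hR : (∑ j, star (wc j) * vc j).re = w ⬝ᵥ v := by
    have : ∀ j, star (wc j) * vc j = ((w j * v j : ℝ) : ℂ) := fun j => by simp [hwc, hvc, Complex.conj_ofReal]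
    simp_rw [this]
    rw [← Complex.ofReal_sum, Complex.ofReal_re]
    rfl
  rw [hL, hR] at h
  -- `v·Cv = w·v`, Cauchy–Schwarz `(w·v)² ≤ (w·w)(v·v)`
  have hform : v ⬝ᵥ (C *ᵥ v) = w ⬝ᵥ v := by rw [hw]; exact dotProduct_comm _ _
  have hCS : (w ⬝ᵥ v) ^ 2 ≤ (w ⬝ᵥ w) * (v ⬝ᵥ v) := by
    have := Finset.sum_mul_sq_le_sq_mul_sq Finset.univ w v
    simpa only [dotProduct, sq] using this
  have hww : 0 ≤ w ⬝ᵥ w := Finset.sum_nonneg fun j _ => mul_self_nonneg (w j)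
  have hvv : 0 ≤ v ⬝ᵥ v := Finset.sum_nonneg fun j _ => mul_self_nonneg (v j)
  have hs0 : 0 ≤ w ⬝ᵥ v := le_trans (mul_nonneg hm.le hww) h
  rw [hform, div_mul_eq_mul_div, le_div_iff₀ hm, one_mul]
  rcases hs0.eq_or_lt with hs | hs
  · rw [← hs, zero_mul]; exact hvv
  · have h2 : (w ⬝ᵥ v) * m * (w ⬝ᵥ v) ≤ (v ⬝ᵥ v) * (w ⬝ᵥ v) := by nlinarith
    exact le_of_mul_le_mul_right h2 hs

end LinearAlgebra

/-! ## §2. The per-term readers: `v·Cv ≤ |v|²∕m_A`, `|Γ₀ᵢⱼ| ≤ B_Γ e^{−ρ′d}`, and the form bound `hΓq` -/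

section OneTerm

variable {c : B13.Consts} {d N' ν : ℕ} {Nf : Fin ν → ℕ} [∀ i, NeZero (Nf i)]
variable {E : Type*} [NormedAddCommGroup E] [NormedSpace ℂ E]

/-- `σ = 0` lies in the polydisc `‖σ_j‖ ≤ e^{κ₁}` (private helper). [folklore] -/
private theorem zero_mem_polydisc (c : B13.Consts) : ∀ j, ‖(0 : TPt d N' → ℂ) j‖ ≤ Real.exp c.κ₁ :=
  fun _ => by simpa using (Real.exp_pos c.κ₁).le

/-- **THE REFERENCE COVARIANCE's FORM FROM THE RUNG**: a term carrying `TermWalks 𝒦 q` (`q` admissible) has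
`v·Cv ≤ |v|²∕m_A` for every real `v` (`C = A(0,0)⁻¹`, accretivity of `A` at `σ = 0`, `u = 0`) — the companion of
`B13NodeTorusWalksAccretive.eigenvalues_C_le_of_termWalks`, in form currency. [cite: Balaban1988RG2Cluster, p.15, (2.24)–(2.25) p.17] -/
theorem form_C_le_of_termWalks {𝒦 : TermKernels c d N' ν Nf E} [Fintype 𝒦.C₀] [DecidableEq 𝒦.C₀] {q : WalkPackage}
    (hq : q.Admissible) (hw : TermWalks 𝒦 q) (v : 𝒦.Λ → ℝ) :
    v ⬝ᵥ (𝒦.C *ᵥ v) ≤ 1 / q.mA * (v ⬝ᵥ v) :=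
  form_inv_le_of_accretive 𝒦.hC 𝒦.hC0 hq.hmA (hw.accA 0 (zero_mem_polydisc c) 0 (mem_ball_self hq.hR)) v

/-- **THE REFERENCE Γ-KERNEL's ENTRIES FROM THE RUNG**: `|Γ₀ᵢⱼ| ≤ B_Γ e^{−ρ′ d₁(loc i, loc j)}` at any rate book — the decay
letter of `Γ₀ = Re G(0,0)` (`termLetters_of_termWalks`, `TermLetters.hΓ.decay` at the reference pair, `𝒦.hG0`).
[cite: Balaban1988RG2Cluster, p.15, (2.16) p.16; Balaban1985BackgroundPropagators, Thm 3.10 p.416] -/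
theorem abs_gamma0_le_of_termWalks {𝒦 : TermKernels c d N' ν Nf E} [Fintype 𝒦.C₀] [DecidableEq 𝒦.C₀] {q : WalkPackage}
    (hq : q.Admissible) (r : RateBook q) (hw : TermWalks 𝒦 q) (i : 𝒦.Λ) (j : 𝒦.Λ ⊕ 𝒦.C₀) :
    |𝒦.Γ₀ i j| ≤ q.BΓ * Real.exp (-(r.ρ' * tdist1 Nf (𝒦.locΛ i) (𝒦.locN j))) := by
  have h := (termLetters_of_termWalks hq r hw).hΓ.decay 0 (zero_mem_polydisc c) 0 (mem_ball_self hq.hR) i j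
  have e : 𝒦.G2 0 0 i j = (𝒦.Γ₀ i j : ℂ) := by rw [𝒦.hG0, Matrix.map_apply, Complex.coe_algebraMap]
  rw [e, Complex.norm_real, Real.norm_eq_abs] at h
  exact h

/-- ★ **NODE A's FORM BOUND `hΓq` IS A NUMBER OF THE PACKAGE.**  A term carrying `TermWalks 𝒦 q` — `q` admissible with positive
rates, `0 < η ≤ etaMax` (standard rate book: `ρ′ = μ∕4 ≥ η`) — whose row locations have fibres `≤ m`, on a torus of dimension
`ν ≤ d_m`, satisfies, for EVERY real `X`,
`(Γ₀ X)·(C (Γ₀ X)) ≤ (B_Γ c_V)(B_Γ · m c₀(1,η)^{d_m}) ∕ m_A · (X·X)`: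
the form of `C` is `≤ |·|²∕m_A` (`form_C_le_of_termWalks`) and `|Γ₀X|² ≤ (row ℓ¹)(column ℓ¹)|X|²` (Schur) with rows
`Σ_j |Γ₀ᵢⱼ| ≤ B_Γ Σ_j e^{−η d(locΛ i, locN j)} ≤ B_Γ c_V` (`volΛN`) and columns `Σ_i |Γ₀ᵢⱼ| ≤ B_Γ · m c₀(1,η)^{d_m}`
(`volume_of_multiplicity`).  The constant is UNIFORM over the terms of a family carrying the rung with one package, one fibre
letter and one dimension bound — exactly the letters the walks leaves already carry (`hfibΛ`, `(𝓣 s₀).ν`); so their binder `hΓq`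
holds with `g_q := B_Γ² c_V · m c₀(1,η)^{d_m} ∕ m_A`.  The rung for Bałaban's kernels is NOT supplied here.
[cite: Balaban1988RG2Cluster, p.15, (2.16) p.16, (2.24)–(2.25) p.17; Balaban1984PropagatorsII, Lemma 2.1 (2.61) p.234] -/
theorem gammaForm_le_of_termWalks {𝒦 : TermKernels c d N' ν Nf E} [Fintype 𝒦.C₀] [DecidableEq 𝒦.C₀] {q : WalkPackage}
    (hq : q.Admissible) (hp : q.PositiveRates) (hη : q.η ≤ q.etaMax) (hη0 : 0 < q.η) (hw : TermWalks 𝒦 q)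
    {m dm : ℕ} (hfibΛ : ∀ x : UT Nf, (Finset.univ.filter fun i => 𝒦.locΛ i = x).card ≤ m) (hν : ν ≤ dm)
    (X : 𝒦.Λ ⊕ 𝒦.C₀ → ℝ) :
    (𝒦.Γ₀ *ᵥ X) ⬝ᵥ (𝒦.C *ᵥ (𝒦.Γ₀ *ᵥ X)) ≤
      (q.BΓ * q.cV) * (q.BΓ * (m * B6.c0 1 q.η ^ dm)) / q.mA * (X ⬝ᵥ X) := by
  have hρ' : (q.stdRates hq hp hη).ρ' = q.mu / 4 := (WalkPackage.stdRates_pos q hq hp hη).2.2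
  have hηρ : q.η ≤ (q.stdRates hq hp hη).ρ' := by rw [hρ']; exact hη.trans (min_le_left _ _)
  have hB : 0 ≤ q.BΓ := WalkPackage.BΓ_nonneg hq
  -- entries at the volume rate `η ≤ ρ′`
  have hent : ∀ i j, |𝒦.Γ₀ i j| ≤ q.BΓ * Real.exp (-(q.η * tdist1 Nf (𝒦.locΛ i) (𝒦.locN j))) := fun i j =>
    (abs_gamma0_le_of_termWalks hq (q.stdRates hq hp hη) hw i j).trans
      (mul_le_mul_of_nonneg_left (Real.exp_le_exp.2 (by
        have hd := tdist1_nonneg (𝒦.locΛ i) (𝒦.locN j)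
        nlinarith [mul_le_mul_of_nonneg_right hηρ hd])) hB)
  -- rows by the rung's volume clause `volΛN`
  have hrow : ∀ i, ∑ j, |𝒦.Γ₀ i j| ≤ q.BΓ * q.cV := fun i =>
    (Finset.sum_le_sum fun j _ => hent i j).trans
      (by rw [← Finset.mul_sum]; exact mul_le_mul_of_nonneg_left (hw.volΛN i) hB)
  -- columns by torus geometry: multiplicity of `locΛ` × the row sum (2.61)
  have hcol : ∀ j, ∑ i, |𝒦.Γ₀ i j| ≤ q.BΓ * (m * B6.c0 1 q.η ^ dm) := fun j =>
    (Finset.sum_le_sum fun i _ => hent i j).trans (by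
      rw [← Finset.mul_sum]
      refine mul_le_mul_of_nonneg_left ?_ hB
      have h := volume_of_multiplicity 𝒦.locΛ hfibΛ hη0 hν (𝒦.locN j)
      calc ∑ i, Real.exp (-(q.η * tdist1 Nf (𝒦.locΛ i) (𝒦.locN j)))
          = ∑ i, Real.exp (-(q.η * tdist1 Nf (𝒦.locN j) (𝒦.locΛ i))) :=
            Finset.sum_congr rfl fun i _ => by rw [tdist1_comm]
        _ ≤ m * B6.c0 1 q.η ^ dm := h)
  -- Schur, then the form of `C`
  have hS := schur_sq_le 𝒦.Γ₀ (mul_nonneg hB hq.hcV) hrow hcol X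
  have hmA := hq.hmA
  calc (𝒦.Γ₀ *ᵥ X) ⬝ᵥ (𝒦.C *ᵥ (𝒦.Γ₀ *ᵥ X)) ≤ 1 / q.mA * ((𝒦.Γ₀ *ᵥ X) ⬝ᵥ (𝒦.Γ₀ *ᵥ X)) :=
        form_C_le_of_termWalks hq hw (𝒦.Γ₀ *ᵥ X)
    _ ≤ 1 / q.mA * ((q.BΓ * q.cV) * (q.BΓ * (m * B6.c0 1 q.η ^ dm)) * (X ⬝ᵥ X)) :=
        mul_le_mul_of_nonneg_left hS (by positivity)
    _ = (q.BΓ * q.cV) * (q.BΓ * (m * B6.c0 1 q.η ^ dm)) / q.mA * (X ⬝ᵥ X) := by ring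

end OneTerm

end Literature.MathematicalPhysics.QuantumFieldTheory.Balaban1983to89.B13NodeTorusWalksGammaForm

end
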